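import Summits.QuantumFields.BalabanUV.T4Continuum.Spine.NE2BalabanFinalRate
import Summits.QuantumFields.BalabanUV.T4Continuum.Spine.NE2BalabanFromNE3
import Summits.QuantumFields.BalabanUV.T4Continuum.Support.OutputRateTowerBalaban
import Summits.QuantumFields.BalabanUV.T4Continuum.Spine.NE2ColourPerturbedLayerRate

/-!
# T⁴ programme, spine node NE2 (U1a), tier B row B8 «general rate» (owner rulings R17 (c) / R19), PART 5 — ROOT B AT A GENERAL RATE
# ON NODE NE3's OWN CARRIER (the row-B6′ twin), ROW NE5's W1 SOCKET AT A GENERAL RATE (the row-B7.j twin), AND THE ANY-RATE FORM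

NE2 formalisation swarm `b2b-balaban-t4-ne2-formalise-*`, leaf prover 06 (gen 2; row B3.b-conc lineage), INTENT CLAIMS.log l.12729 / l.12733
(2026-08-20).  APPEND-ONLY TWIN MODULE: nothing landed is edited; every input is consumed BY NAME:
 * PART 4 (leaf-08-g2) `Spine/NE2BalabanFinalRate`: the END `balaban_final_rate_of_regular_rate` (ROOT B at `t = 1`, rate `θ ∈ [L⁻¹, 1)`,
   binders `hreg`, `hNE3θ : LocalRate (bgReadings (regClass (liftR Rg))) C θ`, `0 < a′`, `α, β ≤ η ≤ etaStar o d a a′`) and its law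
   `perturbationLaws_balaban_final_rate`;
 * row B6′ (leaf-08-g2) `Spine/NE2BalabanFromNE3.localRate_minActReadings_iff` — ALREADY RATE-GENERIC: node U1b's `LocalRate` on the NE3
   lineage's carrier `MinimalActionRate.minActReadings d 𝒞 L N dom (ne2Loc L M Rt)` IS ROOT B's binder for every admissible datum;
 * row B7.j (leaf-08-g2) `Support/OutputRateTowerBalaban.norm_one_mul_kappaBs_lt_one_of_regular` (the Neumann-disc condition at `t = 1`
   under the one threshold) and row NE5's socket engine `OutputRateTowerInstance.towerLaw_perturbed` (RATE-GENERIC);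
 * node U1b's `T4EtaRateMin.LocalRate.mono` (monotonicity in the rate) and the owner's `NE2ColourPerturbedLayerRate.const_mul_invPow_le`.

WHAT THIS FILE PROVES (bookkeeping; no new estimate, no new constant):
 * §1 **`balaban_final_rate_of_regular_anyRate`** — ONE END FOR EVERY NE3 RATE `θ ∈ [0, 1)`: `LocalRate … C θ` ⟹ ROOT B's
   `TowerLimitRate … (max θ L⁻¹)` (an NE3 supply faster than King's free defects is capped at `L⁻¹`, a slower one passes through:
   `LocalRate.mono` in the rate, then PART 4's END at `max θ L⁻¹ ∈ [L⁻¹, 1)`); the record (θ = L⁻¹) is the special case — PART 4's own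
   kernel `example` — neither edited nor superseded;
 * §2 ON NODE NE3's CARRIER: **`balaban_final_rate_of_minActReadings_rate`** (`L⁻¹ ≤ θ < 1`), **`…_anyRate`** (`0 ≤ θ < 1`, rate
   `max θ L⁻¹`) and **`balaban_final_rate_of_ne3Shape_anyRate`** — from node U1b's FULL shape `NE3Shape (minActReadings …) C θ`, which
   carries its own honest rate `0 ≤ θ < 1`, ROOT B fires at rate `max θ L⁻¹` with NO rate hypothesis left to display
   (`NE2BalabanFromNE3.balaban_final_rate_of_minActReadings` / `_of_ne3Shape` are the faces `θ ≤ L⁻¹`);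
 * §3 ROW NE5's W1 SOCKET AT A GENERAL RATE: **`towerLaw_balaban_final_of_regular_rate`** —
   `TowerLaw (fun _ ↦ Q_L ⊗ 1) (pertTower (Δ_a ⊗ 1) (j ↦ P_B(Rg j)) 1) L^d (Cpert κ_B (2dCst) CJ C₂^B 0 1) θ` for a family in row B5's class
   with node NE3's `LocalRate … C θ` per member (`L⁻¹ ≤ θ ≤ 1`; `OutputRateTowerBalaban.towerLaw_balaban_final_of_regular` is `θ = L⁻¹`), the
   datum-indexed face **`towerLaw_balaban_final_of_minActReadings_rate`** (ONE NE3-type binder on NE3's carrier) and the any-rate faces.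

HONEST FRAMING (T4-DAG p. 1).  MODEL LEVEL (transporters `Rg` are DATA; GLOBAL small field; no dictionary B0 — trigger c5); node NE3's
`LocalRate` / `NE3Shape` are DISPLAYED binders consumed BY NAME (c2/c7) — NOTHING of node NE3 is proved here, and whether NE3 can supply sup
currency at some `θ > L⁻¹` is the open content side of GAPS G-ne2leaf08g2-1; finite torus, linear layer, operator norm; constants OURS and
UNCHANGED; the instance of record (`θ = L⁻¹`) neither edited nor superseded; tier B = NE2⁺ (single-region, operator norm, model level)
CONDITIONAL on NE3's `LocalRate` + the (3.35)-class + the explicit threshold (T4-DAG writer's ruling Q-NE2-c1) — **NE2 (U1a) NOT PROVED**; NE5 NOT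
proved; spine PROVED 0/9 unchanged; rung (B)+1 on one finite T⁴ — NOT infinite volume, NOT a mass gap, NOT Clay.  HONEST DEPENDENCY: continuum YM
on T⁴ ⇐ BetaPertH ∧ nine spine estimates (0/9 proved); BetaPertH ⇐ (D1) ∧ (D4) ∧ CAP+tail; G-an2-4 gates asym, D1 and NE2/3/4.  ABSOLUTE RULE
kept: no internally-minted statement enters as a cited fact; no `def … : Prop` fact; no new definition; no `sorry`.
-/

noncomputable section

open scoped BigOperators ComplexConjugate Matrix Matrix.Norms.L2Operator Kronecker

namespace Summit.QuantumFields.BalabanUV.T4Continuum.NE2BalabanFinalRateCarriers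

open Literature.MathematicalPhysics.QuantumFieldTheory.Balaban1983to89
open Literature.MathematicalPhysics.QuantumFieldTheory.Balaban1983to89.B5Prop11Plancherel (Cst Cst_nonneg Tor fine)
open Literature.MathematicalPhysics.QuantumFieldTheory.Balaban1983to89.B5G183RateUnitTower (lev lev_neZero)
open Literature.MathematicalPhysics.QuantumFieldTheory.Balaban1983to89.T4EtaRateMin (Readings LocalRate NE3Shape)
open Summit.QuantumFields.BalabanUV.T4Continuum
open Summit.QuantumFields.BalabanUV.T4Continuum.CovariantAveragingTower
open Summit.QuantumFields.BalabanUV.T4Continuum.BackgroundResolventTower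
open Summit.QuantumFields.BalabanUV.T4Continuum.OutputRateTowerSocket
open Summit.QuantumFields.BalabanUV.T4Continuum.OutputRateTowerInstance
open Summit.QuantumFields.BalabanUV.T4Continuum.BalabanAveragedTowerUnit (idx Qlev)
open Summit.QuantumFields.BalabanUV.T4Continuum.KingPairingPlantedLaw (calDalev JpcT CJ CJ_nonneg)
open Summit.QuantumFields.BalabanUV.T4Continuum.GramPerturbationLaw (C2gram)
open Summit.QuantumFields.BalabanUV.T4Continuum.NE2FromNE3 (bgReadings)
open Summit.QuantumFields.BalabanUV.T4Continuum.NE2ColourPerturbedLayer (freeTowerLaws_king_kron pow_d_pos)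
open Summit.QuantumFields.BalabanUV.T4Continuum.NE2ColourPerturbedLayerRate (const_mul_invPow_le)
open Summit.QuantumFields.BalabanUV.T4Continuum.CovariantAveragingSummand (kappaQ kappaQ_ofReal)
open Summit.QuantumFields.BalabanUV.T4Continuum.RegularBackgroundTower (RegularTransporters regClass betaNE3)
open Summit.QuantumFields.BalabanUV.T4Continuum.GaugeTermPerturbationLaw (deltaK)
open Summit.QuantumFields.BalabanUV.T4Continuum.GaugeTermScalarData (QuT Q1)
open Summit.QuantumFields.BalabanUV.T4Continuum.GaugeTermInstanceGeom (gS)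
open Summit.QuantumFields.BalabanUV.T4Continuum.ScalarAveragedCompression (sigma0)
open Summit.QuantumFields.BalabanUV.T4Continuum.ScalarCovariantLaplacian (kappaS)
open Summit.QuantumFields.BalabanUV.T4Continuum.RegularSiteTransporters (siteT)
open Summit.QuantumFields.BalabanUV.T4Continuum.NestedContourTransport (theta0)
open Summit.QuantumFields.BalabanUV.T4Continuum.NE2BalabanRoot (balabanPert)
open Summit.QuantumFields.BalabanUV.T4Continuum.NE2BalabanGauge (gaugeSlot liftR)
open Summit.QuantumFields.BalabanUV.T4Continuum.NE2BalabanLayerSharp (kappaBs C2Bs KstarR)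
open Summit.QuantumFields.BalabanUV.T4Continuum.NE2BalabanWiring (epsR CdeltaR epsR_nonneg)
open Summit.QuantumFields.BalabanUV.T4Continuum.NE2BalabanFinal (tauR kappa4F C4F)
open Summit.QuantumFields.BalabanUV.T4Continuum.NE2BalabanThreshold (etaStar smallness_of_le balaban_final_rate_of_regular)
open Summit.QuantumFields.BalabanUV.T4Continuum.NE2BalabanFinalRate (perturbationLaws_balaban_final_rate balaban_final_rate_of_regular_rate)
open Summit.QuantumFields.BalabanUV.T4Continuum.NE2FromNE3Carrier (ne2Loc)
open Summit.QuantumFields.BalabanUV.T4Continuum.NE2BalabanFromNE3 (localRate_minActReadings_iff)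
open Summit.QuantumFields.BalabanUV.T4Continuum.OutputRateTowerBalaban (norm_one_mul_kappaBs_lt_one norm_one_mul_kappaBs_lt_one_of_regular)
open Summit.QuantumFields.BalabanUV.T4Continuum.MinimalActionRate (minActReadings)

variable {d : ℕ} (L : ℕ) [NeZero L] (M : Fin d → ℕ) [hM : ∀ μ, NeZero (M μ)] (a : ℝ) (ha : 0 < a)
variable {o : Type*} [Fintype o] [DecidableEq o]

omit [NeZero L] in
/-- the any-rate exponent `max θ L⁻¹` lies in the engine's window `[L⁻¹, 1)` for `θ < 1`, `L ≥ 2` (`L⁻¹ < 1` is the owner's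
`NE2BalabanDecayRate.invL_lt_one`; inlined here to keep the import cone minimal). [folklore] -/
theorem max_rate_window (hL : 2 ≤ L) {θ : ℝ} (hθ1 : θ < 1) :
    ((L : ℝ)⁻¹) ≤ max θ ((L : ℝ)⁻¹) ∧ max θ ((L : ℝ)⁻¹) < 1 :=
  ⟨le_max_right _ _, max_lt hθ1 (inv_lt_one_of_one_lt₀ (by exact_mod_cast (lt_of_lt_of_le one_lt_two hL : 1 < L)))⟩

/-- `L⁻¹ ≤ 1` for `L ≥ 1` (`NeZero L`). [folklore] -/
theorem inv_le_one_of_one_le_L : ((L : ℝ)⁻¹) ≤ 1 :=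
  inv_le_one_of_one_le₀ (by exact_mod_cast Nat.one_le_iff_ne_zero.mpr (NeZero.ne L))

/-! ## §1 ROOT B for every NE3 rate `θ ∈ [0, 1)`: the any-rate END (the record is PART 4's special case `θ = L⁻¹`) -/

section AnyRate

variable {Rg : (k : ℕ) → Fin d → (Tor (fine (lev L k) M) → Matrix o o ℂ)} {α β C θ a' η : ℝ}

/-- **ROOT B AT `t = 1` FOR EVERY NE3 RATE `θ ∈ [0, 1)` — THE ANY-RATE END** (`L ≥ 2`, `d ≥ 1`, `a′ > 0`): for site-based bond transporters
`Rg` (DATA) in row B5's (3.35)-shape class with sizes `α, β ≤ η ≤ etaStar o d a a′` whose coefficient towers `{w, Dw}` obey NODE NE3's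
`LocalRate … C θ` (BY NAME, OPEN, displayed) with ANY honest rate `0 ≤ θ < 1`, the lifted King-averaged unit-lattice covariances of
`(Δ_a^{(k)} ⊗ 1 + P_k)⁻¹` CONVERGE with rate `(max θ L⁻¹)^k` and the constant of record — PART 4's `balaban_final_rate_of_regular_rate` at
`max θ L⁻¹ ∈ [L⁻¹, 1)` after `LocalRate.mono` in the rate (an NE3 supply faster than King's free defects `2dCst·L^{−k}`, `CJ·L^{−k}` is capped
at `L⁻¹`; a slower one passes through unchanged).  Model level (no B0); NE2 (U1a) NOT proved by this (tier B = NE2⁺ single-region, operator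
norm, conditional); NE3 NOT proved. [cite: Balaban1985BackgroundPropagators, (3.26) p.395, (3.35) p.396 (shapes)] [folklore] -/
theorem balaban_final_rate_of_regular_anyRate (hL : 2 ≤ L) (hd : 1 ≤ d) (hreg : RegularTransporters L M (liftR L M Rg) α β)
    (hC : 0 ≤ C) (hθ0 : 0 ≤ θ) (hθ1 : θ < 1) (hNE3θ : LocalRate (bgReadings L M (regClass L M (liftR L M Rg))) C θ)
    (ha' : 0 < a') (hαη : α ≤ η) (hβη : β ≤ η) (hη : η ≤ etaStar o d a a') :
    TowerLimitRate (fun k => Qlev L M k ⊗ₖ (1 : Matrix o o ℂ)) ((L : ℝ) ^ d)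
      (fun k => (calDalev L M a ha k ⊗ₖ (1 : Matrix o o ℂ)
        + balabanPert L M a (liftR L M Rg) (gaugeSlot L M Rg (QuT L M o (siteT L M Rg)) (Q1 L M o) a') k)⁻¹)
      (Cpert (kappaBs o d a α β (a * (epsR o d α * (2 + epsR o d α) * Cst d a)) (kappa4F d a a' α β))
        (2 * d * Cst d a) (CJ d a)
        (C2Bs o d L a α β C
          (a * C2gram (Cst d a) 1 (epsR o d α) (2 * d * Cst d a) (CJ d a) (Cst d a) (CdeltaR o d a α (theta0 d α (betaNE3 o C))))
          (C4F o d L a a' α β C)) 0 1) (max θ ((L : ℝ)⁻¹)) := by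
  obtain ⟨hlo, hhi⟩ := max_rate_window L hL hθ1
  exact balaban_final_rate_of_regular_rate L M a ha hd hreg hC hlo hhi (hNE3θ.mono le_rfl hθ0 (le_max_left _ _) hC)
    ha' hαη hβη hη

/-! (R19 (b)(ii) for the END itself — the record `NE2BalabanThreshold.balaban_final_rate_of_regular` re-derived at `θ = L⁻¹` — is the kernel
`example` at the end of PART 4 `Spine/NE2BalabanFinalRate`; not repeated here.) -/

end AnyRate

/-! ## §2 On node NE3's own carrier `MinimalActionRate.minActReadings … (ne2Loc …)`: rate `θ ≥ L⁻¹`, any rate, and `NE3Shape` -/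

section Carrier

variable {𝒞 : ℕ → Set (B7Prop1Explicit.Site d → Fin d → (Matrix o o ℂ)ˣ)} {N : ℕ}
  {dom : Set (B7Prop1Explicit.Site d → Fin d → (Matrix o o ℂ)ˣ)}
  {Rg : (B7Prop1Explicit.Site d → Fin d → (Matrix o o ℂ)ˣ) → ((k : ℕ) → Fin d → (Tor (fine (lev L k) M) → Matrix o o ℂ))}
  {C θ a' η : ℝ}

/-- **ROOT B AT RATE `θ ∈ [L⁻¹, 1)` FOR THE BACKGROUND OF EVERY ADMISSIBLE DATUM, `hNE3` ON NODE NE3's CARRIER** (`d ≥ 1`, `a′ > 0`; `L ≥ 2` is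
implied by `L⁻¹ ≤ θ < 1`):
if the NE3 lineage's readings `minActReadings d 𝒞 L N dom (ne2Loc L M (liftR ∘ Rg))` satisfy node U1b's `LocalRate … C θ` with `0 ≤ C`,
`L⁻¹ ≤ θ < 1` (OPEN; displayed), then for every `V ∈ dom` whose tower lies in row B5's class with `α, β ≤ η ≤ η⋆`, PART 4's END
`balaban_final_rate_of_regular_rate` fires VERBATIM for `Rg V` at rate `θ` (`NE2BalabanFromNE3.localRate_minActReadings_iff` BY NAME;
`NE2BalabanFromNE3.balaban_final_rate_of_minActReadings` is the face `θ ≤ L⁻¹`).  Model level (no B0); NE2 (U1a) NOT proved; NE3 NOT proved.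
[cite: Balaban1985BackgroundPropagators, (3.26) p.395, (3.35) p.396 (shapes)] [folklore] -/
theorem balaban_final_rate_of_minActReadings_rate (hd : 1 ≤ d) (hC : 0 ≤ C) (hθ : ((L : ℝ)⁻¹) ≤ θ) (hθ1 : θ < 1)
    (hNE3 : LocalRate (minActReadings d 𝒞 L N dom (ne2Loc L M fun V => liftR L M (Rg V))) C θ)
    {V : B7Prop1Explicit.Site d → Fin d → (Matrix o o ℂ)ˣ} (hV : V ∈ dom)
    {α β : ℝ} (hreg : RegularTransporters L M (liftR L M (Rg V)) α β) (ha' : 0 < a')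
    (hαη : α ≤ η) (hβη : β ≤ η) (hη : η ≤ etaStar o d a a') :
    TowerLimitRate (fun k => Qlev L M k ⊗ₖ (1 : Matrix o o ℂ)) ((L : ℝ) ^ d)
      (fun k => (calDalev L M a ha k ⊗ₖ (1 : Matrix o o ℂ)
        + balabanPert L M a (liftR L M (Rg V)) (gaugeSlot L M (Rg V) (QuT L M o (siteT L M (Rg V))) (Q1 L M o) a') k)⁻¹)
      (Cpert (kappaBs o d a α β (a * (epsR o d α * (2 + epsR o d α) * Cst d a)) (kappa4F d a a' α β))
        (2 * d * Cst d a) (CJ d a)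
        (C2Bs o d L a α β C
          (a * C2gram (Cst d a) 1 (epsR o d α) (2 * d * Cst d a) (CJ d a) (Cst d a) (CdeltaR o d a α (theta0 d α (betaNE3 o C))))
          (C4F o d L a a' α β C)) 0 1) θ :=
  balaban_final_rate_of_regular_rate L M a ha hd hreg hC hθ hθ1 ((localRate_minActReadings_iff L M).1 hNE3 V hV)
    ha' hαη hβη hη

/-- **THE ANY-RATE FACE ON NODE NE3's CARRIER** (`0 ≤ θ < 1`): rate `max θ L⁻¹`, §1 through the carrier `Iff`. [folklore] -/
theorem balaban_final_rate_of_minActReadings_anyRate (hL : 2 ≤ L) (hd : 1 ≤ d) (hC : 0 ≤ C) (hθ0 : 0 ≤ θ) (hθ1 : θ < 1)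
    (hNE3 : LocalRate (minActReadings d 𝒞 L N dom (ne2Loc L M fun V => liftR L M (Rg V))) C θ)
    {V : B7Prop1Explicit.Site d → Fin d → (Matrix o o ℂ)ˣ} (hV : V ∈ dom)
    {α β : ℝ} (hreg : RegularTransporters L M (liftR L M (Rg V)) α β) (ha' : 0 < a')
    (hαη : α ≤ η) (hβη : β ≤ η) (hη : η ≤ etaStar o d a a') :
    TowerLimitRate (fun k => Qlev L M k ⊗ₖ (1 : Matrix o o ℂ)) ((L : ℝ) ^ d)
      (fun k => (calDalev L M a ha k ⊗ₖ (1 : Matrix o o ℂ)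
        + balabanPert L M a (liftR L M (Rg V)) (gaugeSlot L M (Rg V) (QuT L M o (siteT L M (Rg V))) (Q1 L M o) a') k)⁻¹)
      (Cpert (kappaBs o d a α β (a * (epsR o d α * (2 + epsR o d α) * Cst d a)) (kappa4F d a a' α β))
        (2 * d * Cst d a) (CJ d a)
        (C2Bs o d L a α β C
          (a * C2gram (Cst d a) 1 (epsR o d α) (2 * d * Cst d a) (CJ d a) (Cst d a) (CdeltaR o d a α (theta0 d α (betaNE3 o C))))
          (C4F o d L a a' α β C)) 0 1) (max θ ((L : ℝ)⁻¹)) :=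
  balaban_final_rate_of_regular_anyRate L M a ha hL hd hreg hC hθ0 hθ1 ((localRate_minActReadings_iff L M).1 hNE3 V hV)
    ha' hαη hβη hη

/-- **ROOT B FROM NODE U1b's FULL SHAPE `NE3Shape` ON NE3's CARRIER, NO RATE HYPOTHESIS LEFT** (`L ≥ 2`, `d ≥ 1`, `a′ > 0`): `NE3Shape … C θ`
carries its own honest rate `0 ≤ θ < 1` (`rate_nonneg`, `rate_lt_one`) and the local half `pointwise`; ROOT B fires for every admissible
datum at rate `max θ L⁻¹` — whatever geometric rate node NE3 eventually supplies.  (`NE2BalabanFromNE3.balaban_final_rate_of_ne3Shape` is the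
face `θ ≤ L⁻¹`.)  Both halves of `NE3Shape` are OPEN and displayed; nothing of node NE3 is proved; NE2 (U1a) NOT proved. [folklore] -/
theorem balaban_final_rate_of_ne3Shape_anyRate (hL : 2 ≤ L) (hd : 1 ≤ d) (hC : 0 ≤ C)
    (hNE3 : NE3Shape (minActReadings d 𝒞 L N dom (ne2Loc L M fun V => liftR L M (Rg V))) C θ)
    {V : B7Prop1Explicit.Site d → Fin d → (Matrix o o ℂ)ˣ} (hV : V ∈ dom)
    {α β : ℝ} (hreg : RegularTransporters L M (liftR L M (Rg V)) α β) (ha' : 0 < a')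
    (hαη : α ≤ η) (hβη : β ≤ η) (hη : η ≤ etaStar o d a a') :
    TowerLimitRate (fun k => Qlev L M k ⊗ₖ (1 : Matrix o o ℂ)) ((L : ℝ) ^ d)
      (fun k => (calDalev L M a ha k ⊗ₖ (1 : Matrix o o ℂ)
        + balabanPert L M a (liftR L M (Rg V)) (gaugeSlot L M (Rg V) (QuT L M o (siteT L M (Rg V))) (Q1 L M o) a') k)⁻¹)
      (Cpert (kappaBs o d a α β (a * (epsR o d α * (2 + epsR o d α) * Cst d a)) (kappa4F d a a' α β))
        (2 * d * Cst d a) (CJ d a)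
        (C2Bs o d L a α β C
          (a * C2gram (Cst d a) 1 (epsR o d α) (2 * d * Cst d a) (CJ d a) (Cst d a) (CdeltaR o d a α (theta0 d α (betaNE3 o C))))
          (C4F o d L a a' α β C)) 0 1) (max θ ((L : ℝ)⁻¹)) :=
  balaban_final_rate_of_minActReadings_anyRate L M a ha hL hd hC hNE3.rate_nonneg hNE3.rate_lt_one hNE3.pointwise hV hreg ha'
    hαη hβη hη

end Carrier

/-! ## §3 Row NE5's W1 socket `TowerLaw` for Bałaban's typed tier-B operator at a general rate -/

section Socket

variable {Jx : Type*} {Rg : Jx → ((k : ℕ) → Fin d → (Tor (fine (lev L k) M) → Matrix o o ℂ))} {α β C θ a' η : ℝ}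

/-- **ROW NE5's W1 LAW AT A GENERAL RATE `θ ∈ [L⁻¹, 1]`, NUMERIC-THRESHOLD FORM** (`d ≥ 1`; `θ ≤ 1` is PART 4's law binder `hθle`): for a family `Rg j` of site-based transporter towers
(DATA) in row B5's (3.35)-shape class with common sizes `α, β`, node NE3's `LocalRate … C θ` BY NAME for every member (OPEN), `a′ > 0`, and the
numeric binders of PART 4's law `perturbationLaws_balaban_final_rate` + the Neumann-disc numbers:
`TowerLaw (fun _ => (Q_L ⊗ 1)) (pertTower (Δ_a ⊗ 1) (fun j => P_B(Rg j)) 1) L^d (Cpert κ_B (2dCst) CJ C₂^B 0 1) θ` — row NE5's RATE-GENERIC socket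
engine `OutputRateTowerInstance.towerLaw_perturbed` over `freeTowerLaws_king_kron` (the free King defects `2dCst·L^{−k}`, `CJ·L^{−k}` majorised by
`·θ^k`, `NE2ColourPerturbedLayerRate.const_mul_invPow_le`), `hpert j := perturbationLaws_balaban_final_rate` (PART 4) BY NAME.
`OutputRateTowerBalaban.towerLaw_balaban_final_of_small` is the case `θ = L⁻¹`.  NE5 / NE2 / NE3 NOT proved. [folklore] -/
theorem towerLaw_balaban_final_of_small_rate (hd : 1 ≤ d) (hreg : ∀ j, RegularTransporters L M (liftR L M (Rg j)) α β) (hC : 0 ≤ C)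
    (hθ : ((L : ℝ)⁻¹) ≤ θ) (hθle : θ ≤ 1) (hNE3θ : ∀ j, LocalRate (bgReadings L M (regClass L M (liftR L M (Rg j)))) C θ)
    (ha' : 0 < a')
    (hκ : kappaS d a' α β (tauR d α) < 1)
    (hsmall : ((sigma0 d a') ^ 2)⁻¹ * deltaK (gS d a' (kappaS d a' α β (tauR d α))) (1 + tauR d α) (d * α) (tauR d α) a' < 1)
    (hα : 0 ≤ α) (hαη : α ≤ η) (hβη : β ≤ η) (hεη : epsR o d α ≤ η) (hκη : kappa4F d a a' α β ≤ η) (hη1 : η ≤ 1)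
    (hηK : η * KstarR o d a < 1) :
    TowerLaw (fun _ : Jx => fun k => Qlev L M k ⊗ₖ (1 : Matrix o o ℂ))
      (pertTower (fun k => calDalev L M a ha k ⊗ₖ (1 : Matrix o o ℂ))
        (fun j => balabanPert L M a (liftR L M (Rg j)) (gaugeSlot L M (Rg j) (QuT L M o (siteT L M (Rg j))) (Q1 L M o) a')) 1)
      ((L : ℝ) ^ d)
      (Cpert (kappaBs o d a α β (a * (epsR o d α * (2 + epsR o d α) * Cst d a)) (kappa4F d a a' α β))
        (2 * d * Cst d a) (CJ d a)
        (C2Bs o d L a α β C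
          (a * C2gram (Cst d a) 1 (epsR o d α) (2 * d * Cst d a) (CJ d a) (Cst d a) (CdeltaR o d a α (theta0 d α (betaNE3 o C))))
          (C4F o d L a a' α β C)) 0 1) θ := by
  refine towerLaw_perturbed (pow_d_pos (d := d) L) (freeTowerLaws_king_kron L M a ha o) (fun j => ?_)
    (const_mul_invPow_le L (by positivity [Cst_nonneg d a]) hθ) (const_mul_invPow_le L (CJ_nonneg d a) hθ) (fun _ _ => le_rfl)
    (fun k => by simp) (norm_one_mul_kappaBs_lt_one a ha.le hα hαη hβη hεη hκη hη1 hηK)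
  have h := perturbationLaws_balaban_final_rate L M a ha hd (hreg j) hC hθ hθle (hNE3θ j) ha' hκ hsmall
  rwa [kappaQ_ofReal ha.le] at h

/-- **ROW NE5's W1 LAW AT A GENERAL RATE `θ ∈ [L⁻¹, 1]` UNDER THE ONE EXPLICIT THRESHOLD** (`d ≥ 1`): the same with the numeric binders replaced by
`α ≤ η`, `β ≤ η`, `η ≤ etaStar o d a a′` (`NE2BalabanThreshold.smallness_of_le` — the threshold does not see `θ`, R19 (c)).
`OutputRateTowerBalaban.towerLaw_balaban_final_of_regular` is the case `θ = L⁻¹`.  NE5 / NE2 / NE3 NOT proved. [folklore] -/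
theorem towerLaw_balaban_final_of_regular_rate (hd : 1 ≤ d) (hreg : ∀ j, RegularTransporters L M (liftR L M (Rg j)) α β) (hα : 0 ≤ α)
    (hβ : 0 ≤ β) (hC : 0 ≤ C) (hθ : ((L : ℝ)⁻¹) ≤ θ) (hθle : θ ≤ 1)
    (hNE3θ : ∀ j, LocalRate (bgReadings L M (regClass L M (liftR L M (Rg j)))) C θ)
    (ha' : 0 < a') (hαη : α ≤ η) (hβη : β ≤ η) (hη : η ≤ etaStar o d a a') :
    TowerLaw (fun _ : Jx => fun k => Qlev L M k ⊗ₖ (1 : Matrix o o ℂ))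
      (pertTower (fun k => calDalev L M a ha k ⊗ₖ (1 : Matrix o o ℂ))
        (fun j => balabanPert L M a (liftR L M (Rg j)) (gaugeSlot L M (Rg j) (QuT L M o (siteT L M (Rg j))) (Q1 L M o) a')) 1)
      ((L : ℝ) ^ d)
      (Cpert (kappaBs o d a α β (a * (epsR o d α * (2 + epsR o d α) * Cst d a)) (kappa4F d a a' α β))
        (2 * d * Cst d a) (CJ d a)
        (C2Bs o d L a α β C
          (a * C2gram (Cst d a) 1 (epsR o d α) (2 * d * Cst d a) (CJ d a) (Cst d a) (CdeltaR o d a α (theta0 d α (betaNE3 o C))))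
          (C4F o d L a a' α β C)) 0 1) θ := by
  obtain ⟨h1, h2, h3, h4, h5, h6, h7, h8⟩ := smallness_of_le (o := o) (d := d) a ha.le ha' hα hβ hαη hβη hη
  exact towerLaw_balaban_final_of_small_rate L M a ha hd hreg hC hθ hθle hNE3θ ha' h1 h2 hα h3 h4 h5 h6 h7 h8

/-- **ROW NE5's W1 LAW, ANY-RATE FACE** (`0 ≤ θ ≤ 1`): node NE3's `LocalRate … C θ` per member ⟹ `TowerLaw … (max θ L⁻¹)`. [folklore] -/
theorem towerLaw_balaban_final_of_regular_anyRate (hd : 1 ≤ d) (hreg : ∀ j, RegularTransporters L M (liftR L M (Rg j)) α β) (hα : 0 ≤ α)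
    (hβ : 0 ≤ β) (hC : 0 ≤ C) (hθ0 : 0 ≤ θ) (hθle : θ ≤ 1)
    (hNE3θ : ∀ j, LocalRate (bgReadings L M (regClass L M (liftR L M (Rg j)))) C θ)
    (ha' : 0 < a') (hαη : α ≤ η) (hβη : β ≤ η) (hη : η ≤ etaStar o d a a') :
    TowerLaw (fun _ : Jx => fun k => Qlev L M k ⊗ₖ (1 : Matrix o o ℂ))
      (pertTower (fun k => calDalev L M a ha k ⊗ₖ (1 : Matrix o o ℂ))
        (fun j => balabanPert L M a (liftR L M (Rg j)) (gaugeSlot L M (Rg j) (QuT L M o (siteT L M (Rg j))) (Q1 L M o) a')) 1)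
      ((L : ℝ) ^ d)
      (Cpert (kappaBs o d a α β (a * (epsR o d α * (2 + epsR o d α) * Cst d a)) (kappa4F d a a' α β))
        (2 * d * Cst d a) (CJ d a)
        (C2Bs o d L a α β C
          (a * C2gram (Cst d a) 1 (epsR o d α) (2 * d * Cst d a) (CJ d a) (Cst d a) (CdeltaR o d a α (theta0 d α (betaNE3 o C))))
          (C4F o d L a a' α β C)) 0 1) (max θ ((L : ℝ)⁻¹)) :=
  towerLaw_balaban_final_of_regular_rate L M a ha hd hreg hα hβ hC (le_max_right _ _) (max_le hθle (inv_le_one_of_one_le_L L))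
    (fun j => (hNE3θ j).mono le_rfl hθ0 (le_max_left _ _) hC) ha' hαη hβη hη

end Socket

/-! ## §4 Row NE5's W1 socket at a general rate, the family = the admissible data of node NE3's carrier -/

section SocketCarrier

variable {𝒞 : ℕ → Set (B7Prop1Explicit.Site d → Fin d → (Matrix o o ℂ)ˣ)} {N : ℕ}
  {dom : Set (B7Prop1Explicit.Site d → Fin d → (Matrix o o ℂ)ˣ)}
  {Rg : (B7Prop1Explicit.Site d → Fin d → (Matrix o o ℂ)ˣ) → ((k : ℕ) → Fin d → (Tor (fine (lev L k) M) → Matrix o o ℂ))}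
  {α β C θ a' η : ℝ}

/-- **ROW NE5's W1 LAW AT RATE `θ ∈ [L⁻¹, 1]`, THE FAMILY = THE ADMISSIBLE DATA OF NODE NE3's CARRIER** (`d ≥ 1`): ONE NE3-type binder — node U1b's
`LocalRate … C θ` on `MinimalActionRate.minActReadings d 𝒞 L N dom (ne2Loc L M (liftR ∘ Rg))` (OPEN, displayed) —, `RegularTransporters (liftR (Rg V)) α β`
for every `V ∈ dom`, `a′ > 0`, `α, β ≤ η ≤ etaStar o d a a′`:
`TowerLaw (fun _ : ↥dom => (Q_L ⊗ 1)) (pertTower (Δ_a ⊗ 1) (fun V => P_B(Rg V)) 1) L^d (Cpert κ_B (2dCst) CJ C₂^B 0 1) θ` — §3 with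
`hNE3θ V := (localRate_minActReadings_iff).1 hNE3 V` (row B6′).  `OutputRateTowerBalaban.towerLaw_balaban_final_of_minActReadings` is the face
`θ ≤ L⁻¹`.  NE5 / NE2 / NE3 NOT proved; `Rg` DATA (no B0). [folklore] -/
theorem towerLaw_balaban_final_of_minActReadings_rate (hd : 1 ≤ d) (hreg : ∀ V ∈ dom, RegularTransporters L M (liftR L M (Rg V)) α β)
    (hα : 0 ≤ α) (hβ : 0 ≤ β) (hC : 0 ≤ C) (hθ : ((L : ℝ)⁻¹) ≤ θ) (hθle : θ ≤ 1)
    (hNE3 : LocalRate (minActReadings d 𝒞 L N dom (ne2Loc L M fun V => liftR L M (Rg V))) C θ) (ha' : 0 < a')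
    (hαη : α ≤ η) (hβη : β ≤ η) (hη : η ≤ etaStar o d a a') :
    TowerLaw (fun _ : ↥dom => fun k => Qlev L M k ⊗ₖ (1 : Matrix o o ℂ))
      (pertTower (fun k => calDalev L M a ha k ⊗ₖ (1 : Matrix o o ℂ))
        (fun V : ↥dom => balabanPert L M a (liftR L M (Rg V)) (gaugeSlot L M (Rg V) (QuT L M o (siteT L M (Rg V))) (Q1 L M o) a')) 1)
      ((L : ℝ) ^ d)
      (Cpert (kappaBs o d a α β (a * (epsR o d α * (2 + epsR o d α) * Cst d a)) (kappa4F d a a' α β))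
        (2 * d * Cst d a) (CJ d a)
        (C2Bs o d L a α β C
          (a * C2gram (Cst d a) 1 (epsR o d α) (2 * d * Cst d a) (CJ d a) (Cst d a) (CdeltaR o d a α (theta0 d α (betaNE3 o C))))
          (C4F o d L a a' α β C)) 0 1) θ :=
  towerLaw_balaban_final_of_regular_rate L M a ha (Rg := fun V : ↥dom => Rg V) hd (fun V => hreg V V.2) hα hβ hC hθ hθle
    (fun V => (localRate_minActReadings_iff L M).1 hNE3 V V.2) ha' hαη hβη hη

/-- **ROW NE5's W1 LAW FROM NODE U1b's FULL SHAPE ON NE3's CARRIER, NO RATE HYPOTHESIS LEFT** (`d ≥ 1`): `NE3Shape (minActReadings …) C θ` ⟹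
`TowerLaw … (max θ L⁻¹)`.  Both halves of `NE3Shape` OPEN and displayed; NE5 / NE2 / NE3 NOT proved. [folklore] -/
theorem towerLaw_balaban_final_of_ne3Shape_anyRate (hd : 1 ≤ d) (hreg : ∀ V ∈ dom, RegularTransporters L M (liftR L M (Rg V)) α β)
    (hα : 0 ≤ α) (hβ : 0 ≤ β) (hC : 0 ≤ C)
    (hNE3 : NE3Shape (minActReadings d 𝒞 L N dom (ne2Loc L M fun V => liftR L M (Rg V))) C θ) (ha' : 0 < a')
    (hαη : α ≤ η) (hβη : β ≤ η) (hη : η ≤ etaStar o d a a') :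
    TowerLaw (fun _ : ↥dom => fun k => Qlev L M k ⊗ₖ (1 : Matrix o o ℂ))
      (pertTower (fun k => calDalev L M a ha k ⊗ₖ (1 : Matrix o o ℂ))
        (fun V : ↥dom => balabanPert L M a (liftR L M (Rg V)) (gaugeSlot L M (Rg V) (QuT L M o (siteT L M (Rg V))) (Q1 L M o) a')) 1)
      ((L : ℝ) ^ d)
      (Cpert (kappaBs o d a α β (a * (epsR o d α * (2 + epsR o d α) * Cst d a)) (kappa4F d a a' α β))
        (2 * d * Cst d a) (CJ d a)
        (C2Bs o d L a α β C
          (a * C2gram (Cst d a) 1 (epsR o d α) (2 * d * Cst d a) (CJ d a) (Cst d a) (CdeltaR o d a α (theta0 d α (betaNE3 o C))))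
          (C4F o d L a a' α β C)) 0 1) (max θ ((L : ℝ)⁻¹)) :=
  towerLaw_balaban_final_of_regular_anyRate L M a ha (Rg := fun V : ↥dom => Rg V) hd (fun V => hreg V V.2) hα hβ hC hNE3.rate_nonneg
    hNE3.rate_lt_one.le (fun V => (localRate_minActReadings_iff L M).1 hNE3.pointwise V V.2) ha' hαη hβη hη

end SocketCarrier

end Summit.QuantumFields.BalabanUV.T4Continuum.NE2BalabanFinalRateCarriers

end
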